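import Summits.KontsevichZagierPeriods.KontsevichZagierPeriods.Theses.GenusOneIterated
import Summits.KontsevichZagierPeriods.KontsevichZagierPeriods.Theorems.GenusOneIteratedLegendreLemniscatic

/-!
# `DepthThreeFamily` (stmt-KontsevichZagierPeriods-6776, route GenusOneIterated, crux rank 2) — birth skeleton

Crux (verbatim the route decl `…Theses.GenusOneIterated.DepthThreeFamily`): for every real cubic
`y² = f(x) = 4(x−e₁)(x−e₂)(x−e₃)` with real algebraic `e₃ < e₂ < e₁`, `e₁+e₂+e₃ = 0`, and every choice of
representations `r = [e₃<x₀<x₁<x₂<e₂, x₂/(√f(x₀)√f(x₁)√f(x₂))]` (`= I(ωωη)`), `rA = [∫_{e₃}^{e₂} dx/√f]`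
(`= ω₁/2`), `rB = [∫ x dx/√f]` (`= −η₁/2`), `rA' = [∫_{e₂}^{e₁} dx/√(−f)]` (`= |ω₂|/2`, the B-period) and
`rL = [∫₀¹ 16/(1+u) + 8(e₁−e₃−1)/(1+(e₁−e₃−1)u) − 4(e₁−e₂−1)/(1+(e₁−e₂−1)u) − 4(e₂−e₃−1)/(1+(e₂−e₃−1)u) du]`
(`= 16 log 2 + 8 log(e₁−e₃) − 4 log(e₁−e₂) − 4 log(e₂−e₃)`), the DEPTH-THREE DEFECT
`D(e) := 48[r] − 8[rA][rA][rB] + 4[π][rA'] − [rA][rL]` lies in `KZ.relations`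
(the closed form (L1): `I(ωωη) = −η₁ω₁²/48 − π|ω₂|/24 + (ω₁/2)·rL/48`).

Line ("CM anchor + Gauss–Manin transport" — the decomposition the route header names in its
TWO-LAYER PLAN, `DepthThreeFamily ⇐ DepthThreeLemniscatic (anchor) → DepthThreeTransport`, typed here;
nothing new is filed):

* `stub_cuspLemniscatic` — THE CONSTANT OF INTEGRATION at the CM point: verbatim the route crux
  `DepthThreeLemniscatic` (stmt-KontsevichZagierPeriods-6777, rank 3): on `y² = 4x³ − 4x`,
  `8·I(ωωη) ~ ∫_{−1<x₀<0, 0<x₁<1} (4/(1+x₁) − 4/(1+x₁²))/y₀` (`= (ϖ/2)(4 log 2 − π)`). This is where the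
  cusp / `q`-series content of (L1) lives (θ-function evaluation, `E₂(i) = 3/π`); proving item 6777 proves
  this stub by `exact`. Size XL.
* `stub_lemniscaticNormalForm` — LEMNISCATIC BOOKKEEPING (no cusp content, provable now): from
  `LegendreLemniscatic` (landed: `legendreLemniscatic_proof`) and the cusp identity, the defect in the
  family's normal form at `e₀ = (1, 0, −1)` is a relation: `D(e₀) = 48[s] − 8[sA][sA][sB] + 4[π][sA'] − [sA][sL]
  ∈ KZ.relations` for all reps `s = [Δ, x₂/(y₀y₁y₂)]`, `sA = [(−1,0), 1/y]`, `sB = [(−1,0), x/y]`,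
  `sA' = [(0,1), 1/√(4x−4x³)]`, `sL = [(0,1), 24/(1+u)]`. Moves: `[8·g] ~ 8•[g]` (rule 1b ×7),
  `4•([sA][sB]) ~ −[(−1,0)², −4x₁/(y₀y₁)] ~ −[ℝ, dv/(1+v²)] ~ −[piRep]`-class (Legendre at the CM point +
  `piNormalisation_proof`), the CM symmetry `x ↦ −x` giving `sA' ~ sA` (rule 2; `|ω₂| = ω₁` on the
  lemniscatic curve), `[sA]·[(0,1), 4/(1+u)]` as a product rep (Fubini inside the rules, `KZ.of_mul_of`),
  `∫₀¹ 24/(1+u) = 6·∫₀¹ 4/(1+u)`, and the two-sided ideal property of `KZ.relations`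
  (`KZ.mul_mem_relations_left_holds` / `_right_holds`). Value check: `48·I = 12ϖ log 2 − 3πϖ`,
  `−8 sA² sB + 4π sA' − sA sL = πϖ + 2πϖ − 12ϖ log 2`. Size M/L.
* `stub_modulusTransport` — GAUSS–MANIN TRANSPORT OF THE DEFECT (the hardest stub, new content): for
  every admissible `e` and every choice of reps at `e` there are reps in the lemniscatic normal form with
  `D(e) − D(e₀) ∈ KZ.relations`. Plan (template: the landed `stub_legendreModulusPropagation` of the
  CompleteModGammaSector engine and `GaussManinCertificates.LegendreModulusPropagation`): the admissible
  moduli `{e₃<e₂<e₁, Σeᵢ = 0}` form a convex cone, so `e` and `e₀` are joined by an algebraic segment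
  `e(t)`; normalise every domain to a fixed simplex/interval by the affine rule-(2) move
  `x = e₃(t) + (e₂(t) − e₃(t))·ξ` (the endpoint singularities `ξ^{-1/2}`, `(1−ξ)^{-1/2}` then do not move
  with `t`, so `∂ₜ` of the normalised integrands stays absolutely integrable); ONE rule-(3) move in the
  parameter `t` per constituent family with the integrand itself as (algebraic) primitive turns
  `[R_{e}] − [R_{e₀}]` into the `(n+1)`-dimensional family rep `[∫ ∂ₜ(…) dt dξ]`; the Picard–Fuchs / KZB
  reduction of `∂ₜ` of `ω, η` and of the length-3 word (Griffiths pole reduction: RATIONAL fibre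
  primitives, rule 3 in a fibre variable) plus the `t`-derivative of the unfolded logarithm `rL` (rule 3 in
  `u`, rational primitive) leaves a combination that cancels FORMALLY modulo Legendre's relation at every
  modulus — needed for the B-side term `4[π][rA']` (`∂ₜ|ω₂|` produces `|η₂|`) and LANDED in the tree in
  Jacobi form (`UnfoldedStokes.LegendreAllModuliLine.LegendreAllModuli_of`, one algebraic substitution
  `x = e₃ + (e₂−e₃)ξ²` away). Why it might fail = the crux's own risk, sharpened: the KZB reduction of
  `∂ₜ I(ωωη)` may need a fibre primitive that is an elliptic logarithm (transcendental — barrier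
  `noSemialgebraicPrimitive_inv_sub_two`), i.e. the flat section may not be realisable by moves without a
  genuinely 2-dimensional fibre cell. Size XL.

Composition `DepthThreeFamily_of : stub₁-sig → stub₂-sig → stub₃-sig → DepthThreeFamily` (sorry-free, pure
algebra in `KZ.relations`: take the transported lemniscatic reps, apply the glue fed with the landed
`legendreLemniscatic_proof` and the cusp stub, `add_mem`, `sub_add_cancel`); `DepthThreeFamily_skeleton :
DepthThreeFamily` feeds the three stubs in. Disproof used: none on file for this crux (`ledger crux ls`: no
workfiles; no `Theorems/DepthThreeFamily/Negative/*`); `ledger negatives --problem KontsevichZagierPeriods`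
has one entry (KinematicPlaneConvex), unrelated. All statements are over existing declarations only
(`Literature.NumberTheory.Transcendental.KZ.*`, the route decls `LegendreLemniscatic`,
`DepthThreeLemniscatic`, Mathlib).
-/

set_option linter.dupNamespace false

namespace Summit.KontsevichZagierPeriods.KontsevichZagierPeriods.Cruxes.DepthThreeFamily.Birth

open Summit.KontsevichZagierPeriods.KontsevichZagierPeriods.Theses.GenusOneIterated (DepthThreeFamily DepthThreeLemniscatic LegendreLemniscatic)

/-- Stub 1 (CM ANCHOR — the constant of integration; VERBATIM the route crux `DepthThreeLemniscatic`,
stmt-KontsevichZagierPeriods-6777): on the lemniscatic curve `y² = 4x³ − 4x`,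
`8·∫_{−1<x₀<x₁<x₂<0} x₂/(y₀y₁y₂) ~ ∫_{−1<x₀<0, 0<x₁<1} (4/(1+x₁) − 4/(1+x₁²))/y₀`, i.e.
`I(ωωη) = ϖ(4 log 2 − π)/16`. The cusp/`q`-series layer of (L1) (θ-function evaluation, `E₂(i) = 3/π`,
Legendre); certified to 70 digits (refuter job j000974). Sources: arXiv:1301.3042, arXiv:1509.08760,
Lawden1989 Ch. 6, Chudnovsky1976, KontsevichZagier2001 §1.2. Size XL. -/
theorem stub_cuspLemniscatic : ∀ (r : Literature.NumberTheory.Transcendental.KZ.IntegralRep 3) (r' : Literature.NumberTheory.Transcendental.KZ.IntegralRep 2), r.domain = {x | -1 < x 0 ∧ x 0 < x 1 ∧ x 1 < x 2 ∧ x 2 < 0} → Set.EqOn r.integrand (fun x => 8 * x 2 / (Real.sqrt (4 * x 0 ^ 3 - 4 * x 0) * Real.sqrt (4 * x 1 ^ 3 - 4 * x 1) * Real.sqrt (4 * x 2 ^ 3 - 4 * x 2))) r.domain → r'.domain = {x | -1 < x 0 ∧ x 0 < 0 ∧ 0 < x 1 ∧ x 1 < 1} → Set.EqOn r'.integrand (fun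 x => (4 / (1 + x 1) - 4 / (1 + x 1 ^ 2)) / Real.sqrt (4 * x 0 ^ 3 - 4 * x 0)) r'.domain → Literature.NumberTheory.Transcendental.KZ.Equivalent r r' := by
  sorry

/-- Stub 2 (LEMNISCATIC NORMAL FORM — move bookkeeping at the CM point, no cusp content): Legendre at the
CM point (`LegendreLemniscatic`, landed) and the cusp identity (`DepthThreeLemniscatic`) put the depth-three
defect of the family, specialised to `e₀ = (1, 0, −1)` and written in the lemniscatic normal form, into
`KZ.relations`: `48[s] − 8[sA][sA][sB] + 4[π][sA'] − [sA][sL] ∈ KZ.relations`. Moves: rule (1b) for the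
integer factors, the CM symmetry `x ↦ −x` (`sA' ~ sA`, rule 2), Fubini products (`KZ.of_mul_of`),
`∫₀¹ 4 du/(1+u²) ~ [piRep]` (`piNormalisation_proof`), two-sided ideal (`KZ.mul_mem_relations_left_holds`,
`KZ.mul_mem_relations_right_holds`). Sources: KontsevichZagier2001 §1.2, MckeanMoll1999 Ch. 2, Lawden1989
§6.12. Size M/L (provable now). -/
theorem stub_lemniscaticNormalForm : Summit.KontsevichZagierPeriods.KontsevichZagierPeriods.Theses.GenusOneIterated.LegendreLemniscatic → Summit.KontsevichZagierPeriods.KontsevichZagierPeriods.Theses.GenusOneIterated.DepthThreeLemniscatic → ∀ (s : Literature.NumberTheory.Transcendental.KZ.IntegralRep 3) (sA sB sA' sL : Literature.NumberTheory.Transcendental.KZ.IntegralRep 1), s.domain = {x | -1 < x 0 ∧ x 0 < x 1 ∧ x 1 < x 2 ∧ x 2 < 0} → Set.EqOn s.integrand (fun x => x 2 / (Real.sqrt (4 * x 0 ^ 3 - 4 * x 0) * Real.sqrt (4 * x 1 ^ 3 - 4 * x 1) * Real.sqrt (4 * x 2 ^ 3 - 4 * x 2))) s.domain → sA.domain = {x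 | -1 < x 0 ∧ x 0 < 0} → Set.EqOn sA.integrand (fun x => 1 / Real.sqrt (4 * x 0 ^ 3 - 4 * x 0)) sA.domain → sB.domain = {x | -1 < x 0 ∧ x 0 < 0} → Set.EqOn sB.integrand (fun x => x 0 / Real.sqrt (4 * x 0 ^ 3 - 4 * x 0)) sB.domain → sA'.domain = {x | 0 < x 0 ∧ x 0 < 1} → Set.EqOn sA'.integrand (fun x => 1 / Real.sqrt (4 * x 0 - 4 * x 0 ^ 3)) sA'.domain → sL.domain = {x | 0 < x 0 ∧ x 0 < 1} → Set.EqOn sL.integrand (fun x => 24 / (1 + x 0)) sL.domain → 48 • Literature.NumberTheory.Transcendental.KZ.of s - 8 • (Literature.NumberTheory.Transcendental.KZ.of sA * Literature.NumberTheory.Transcendental.KZ.of sA * Literature.NumberTheory.Transcendental.KZ.of sB) + 4 • (Literature.NumberTheory.Transcendental.KZ.of Literature.NumberTheory.Transcendental.KZ.piRep * Literature.NumberTheory.Transcendental.KZ.of sA') - Literature.NumberTheory.Transcendental.KZ.of sA * Literature.NumberTheory.Transcendental.KZ.of sL ∈ Literature.NumberTheory.Transcendental.KZ.relations := by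
  sorry

/-- Stub 3 (GAUSS–MANIN TRANSPORT OF THE DEPTH-THREE DEFECT — the hardest stub): for every admissible
modulus `e` and every choice of representations at `e` there are representations in the lemniscatic normal
form such that `D(e) − D(e₀) ∈ KZ.relations`. Plan: algebraic segment `e(t)` in the convex cone of
admissible moduli; affine normalisation of every domain to a fixed simplex (rule 2); one Newton–Leibniz move
in `t` per constituent family with the integrand as algebraic primitive (rule 3; template: the landed
`stub_legendreModulusPropagation`); Picard–Fuchs/KZB pole reduction in the fibre with RATIONAL primitives
(rule 3) and the rational `t`-derivative of the unfolded logarithm `rL`; formal cancellation modulo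
Legendre's relation at every modulus (landed in Jacobi form: `LegendreAllModuli_of`). Why it might fail:
the KZB reduction of `∂ₜ I(ωωη)` may require an elliptic-logarithm fibre primitive (barrier
`noSemialgebraicPrimitive_inv_sub_two`). Sources: arXiv:1301.3042 §2.4 (modular behaviour of A-elliptic
MZVs), arXiv:1003.1012 §§2–3, MckeanMoll1999 §2.4, KontsevichZagier2001 §1.2. Size XL. -/
theorem stub_modulusTransport : ∀ (e₁ e₂ e₃ : ℝ), IsAlgebraic ℚ e₁ → IsAlgebraic ℚ e₂ → IsAlgebraic ℚ e₃ → e₃ < e₂ → e₂ < e₁ → e₁ + e₂ + e₃ = 0 → ∀ (r : Literature.NumberTheory.Transcendental.KZ.IntegralRep 3) (rA rB rA' rL : Literature.NumberTheory.Transcendental.KZ.IntegralRep 1), r.domain = {x | e₃ < x 0 ∧ x 0 < x 1 ∧ x 1 < x 2 ∧ x 2 < e₂} → Set.EqOn r.integrand (fun x => x 2 / (Real.sqrt (4 * (x 0 - e₁) * (x 0 - e₂) * (x 0 - e₃)) * Real.sqrt (4 * (x 1 - e₁) * (x 1 - e₂) * (x 1 - e₃)) * Real.sqrt (4 * (x 2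 - e₁) * (x 2 - e₂) * (x 2 - e₃)))) r.domain → rA.domain = {x | e₃ < x 0 ∧ x 0 < e₂} → Set.EqOn rA.integrand (fun x => 1 / Real.sqrt (4 * (x 0 - e₁) * (x 0 - e₂) * (x 0 - e₃))) rA.domain → rB.domain = {x | e₃ < x 0 ∧ x 0 < e₂} → Set.EqOn rB.integrand (fun x => x 0 / Real.sqrt (4 * (x 0 - e₁) * (x 0 - e₂) * (x 0 - e₃))) rB.domain → rA'.domain = {x | e₂ < x 0 ∧ x 0 < e₁} → Set.EqOn rA'.integrand (fun x => 1 / Real.sqrt (-(4 * (x 0 - e₁) * (x 0 - e₂) * (x 0 - e₃)))) rA'.domain → rL.domain = {x | 0 < x 0 ∧ x 0 < 1} → Set.EqOn rL.integrand (fun x => 16 / (1 + x 0) + 8 * (e₁ - e₃ - 1) / (1 + (e₁ - e₃ - 1) * x 0) - 4 * (e₁ - e₂ - 1) / (1 + (e₁ - e₂ - 1) * x 0) - 4 * (e₂ - e₃ - 1) / (1 + (e₂ - e₃ - 1) * x 0)) rL.domain → ∃ (s : Literature.NumberTheory.Transcendental.KZ.IntegralRep 3) (sA sB sA' sL : Literature.NumberTheory.Transcendental.KZ.IntegralRep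 1), s.domain = {x | -1 < x 0 ∧ x 0 < x 1 ∧ x 1 < x 2 ∧ x 2 < 0} ∧ Set.EqOn s.integrand (fun x => x 2 / (Real.sqrt (4 * x 0 ^ 3 - 4 * x 0) * Real.sqrt (4 * x 1 ^ 3 - 4 * x 1) * Real.sqrt (4 * x 2 ^ 3 - 4 * x 2))) s.domain ∧ sA.domain = {x | -1 < x 0 ∧ x 0 < 0} ∧ Set.EqOn sA.integrand (fun x => 1 / Real.sqrt (4 * x 0 ^ 3 - 4 * x 0)) sA.domain ∧ sB.domain = {x | -1 < x 0 ∧ x 0 < 0} ∧ Set.EqOn sB.integrand (fun x => x 0 / Real.sqrt (4 * x 0 ^ 3 - 4 * x 0)) sB.domain ∧ sA'.domain = {x | 0 < x 0 ∧ x 0 < 1} ∧ Set.EqOn sA'.integrand (fun x => 1 / Real.sqrt (4 * x 0 - 4 * x 0 ^ 3)) sA'.domain ∧ sL.domain = {x | 0 < x 0 ∧ x 0 < 1} ∧ Set.EqOn sL.integrand (fun x => 24 / (1 + x 0)) sL.domain ∧ (48 • Literature.NumberTheory.Transcendental.KZ.of r - 8 • (Literature.NumberTheory.Transcendental.KZ.of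 rA * Literature.NumberTheory.Transcendental.KZ.of rA * Literature.NumberTheory.Transcendental.KZ.of rB) + 4 • (Literature.NumberTheory.Transcendental.KZ.of Literature.NumberTheory.Transcendental.KZ.piRep * Literature.NumberTheory.Transcendental.KZ.of rA') - Literature.NumberTheory.Transcendental.KZ.of rA * Literature.NumberTheory.Transcendental.KZ.of rL) - (48 • Literature.NumberTheory.Transcendental.KZ.of s - 8 • (Literature.NumberTheory.Transcendental.KZ.of sA * Literature.NumberTheory.Transcendental.KZ.of sA * Literature.NumberTheory.Transcendental.KZ.of sB) + 4 • (Literature.NumberTheory.Transcendental.KZ.of Literature.NumberTheory.Transcendental.KZ.piRep * Literature.NumberTheory.Transcendental.KZ.of sA') - Literature.NumberTheory.Transcendental.KZ.of sA * Literature.NumberTheory.Transcendental.KZ.of sL) ∈ Literature.NumberTheory.Transcendental.KZ.relations := by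
  sorry

/-! ## The composition (sorry-free) -/

/-- **Skeleton theorem, arrow form** (concludes the crux BY NAME): CM anchor → lemniscatic normal form →
Gauss–Manin transport → `DepthThreeFamily`. Pure algebra in the subgroup `KZ.relations`:
`D(e) = (D(e) − D(e₀)) + D(e₀)`. [folklore] -/
theorem DepthThreeFamily_of :
    (∀ (r : Literature.NumberTheory.Transcendental.KZ.IntegralRep 3) (r' : Literature.NumberTheory.Transcendental.KZ.IntegralRep 2), r.domain = {x | -1 < x 0 ∧ x 0 < x 1 ∧ x 1 < x 2 ∧ x 2 < 0} → Set.EqOn r.integrand (fun x => 8 * x 2 / (Real.sqrt (4 * x 0 ^ 3 - 4 * x 0) * Real.sqrt (4 * x 1 ^ 3 - 4 * x 1) * Real.sqrt (4 * x 2 ^ 3 - 4 * x 2))) r.domain → r'.domain = {x | -1 < x 0 ∧ x 0 < 0 ∧ 0 < x 1 ∧ x 1 < 1} → Set.EqOn r'.integrand (fun x => (4 / (1 + x 1) - 4 / (1 + x 1 ^ 2)) / Real.sqrt (4 * x 0 ^ 3 - 4 * x 0)) r'.domain → Literature.NumberTheory.Transcendental.KZ.Equivalent r r') →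
    (Summit.KontsevichZagierPeriods.KontsevichZagierPeriods.Theses.GenusOneIterated.LegendreLemniscatic → Summit.KontsevichZagierPeriods.KontsevichZagierPeriods.Theses.GenusOneIterated.DepthThreeLemniscatic → ∀ (s : Literature.NumberTheory.Transcendental.KZ.IntegralRep 3) (sA sB sA' sL : Literature.NumberTheory.Transcendental.KZ.IntegralRep 1), s.domain = {x | -1 < x 0 ∧ x 0 < x 1 ∧ x 1 < x 2 ∧ x 2 < 0} → Set.EqOn s.integrand (fun x => x 2 / (Real.sqrt (4 * x 0 ^ 3 - 4 * x 0) * Real.sqrt (4 * x 1 ^ 3 - 4 * x 1) * Real.sqrt (4 * x 2 ^ 3 - 4 * x 2))) s.domain → sA.domain = {x | -1 < x 0 ∧ x 0 < 0} → Set.EqOn sA.integrand (fun x => 1 / Real.sqrt (4 * x 0 ^ 3 - 4 * x 0)) sA.domain → sB.domain = {x | -1 < x 0 ∧ x 0 < 0} → Set.EqOn sB.integrand (fun x => x 0 / Real.sqrt (4 * x 0 ^ 3 - 4 * x 0)) sB.domain → sA'.domain = {x | 0 < x 0 ∧ x 0 < 1} → Set.EqOn sA'.integrand (fun x => 1 /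 Real.sqrt (4 * x 0 - 4 * x 0 ^ 3)) sA'.domain → sL.domain = {x | 0 < x 0 ∧ x 0 < 1} → Set.EqOn sL.integrand (fun x => 24 / (1 + x 0)) sL.domain → 48 • Literature.NumberTheory.Transcendental.KZ.of s - 8 • (Literature.NumberTheory.Transcendental.KZ.of sA * Literature.NumberTheory.Transcendental.KZ.of sA * Literature.NumberTheory.Transcendental.KZ.of sB) + 4 • (Literature.NumberTheory.Transcendental.KZ.of Literature.NumberTheory.Transcendental.KZ.piRep * Literature.NumberTheory.Transcendental.KZ.of sA') - Literature.NumberTheory.Transcendental.KZ.of sA * Literature.NumberTheory.Transcendental.KZ.of sL ∈ Literature.NumberTheory.Transcendental.KZ.relations) →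
    (∀ (e₁ e₂ e₃ : ℝ), IsAlgebraic ℚ e₁ → IsAlgebraic ℚ e₂ → IsAlgebraic ℚ e₃ → e₃ < e₂ → e₂ < e₁ → e₁ + e₂ + e₃ = 0 → ∀ (r : Literature.NumberTheory.Transcendental.KZ.IntegralRep 3) (rA rB rA' rL : Literature.NumberTheory.Transcendental.KZ.IntegralRep 1), r.domain = {x | e₃ < x 0 ∧ x 0 < x 1 ∧ x 1 < x 2 ∧ x 2 < e₂} → Set.EqOn r.integrand (fun x => x 2 / (Real.sqrt (4 * (x 0 - e₁) * (x 0 - e₂) * (x 0 - e₃)) * Real.sqrt (4 * (x 1 - e₁) * (x 1 - e₂) * (x 1 - e₃)) * Real.sqrt (4 * (x 2 - e₁) * (x 2 - e₂) * (x 2 - e₃)))) r.domain → rA.domain = {x | e₃ < x 0 ∧ x 0 < e₂} → Set.EqOn rA.integrand (fun x => 1 / Real.sqrt (4 * (x 0 - e₁) * (x 0 - e₂) * (x 0 - e₃))) rA.domain → rB.domain = {x | e₃ < x 0 ∧ x 0 < e₂} → Set.EqOn rB.integrand (fun x => x 0 / Real.sqrt (4 * (x 0 - e₁) * (x 0 -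 e₂) * (x 0 - e₃))) rB.domain → rA'.domain = {x | e₂ < x 0 ∧ x 0 < e₁} → Set.EqOn rA'.integrand (fun x => 1 / Real.sqrt (-(4 * (x 0 - e₁) * (x 0 - e₂) * (x 0 - e₃)))) rA'.domain → rL.domain = {x | 0 < x 0 ∧ x 0 < 1} → Set.EqOn rL.integrand (fun x => 16 / (1 + x 0) + 8 * (e₁ - e₃ - 1) / (1 + (e₁ - e₃ - 1) * x 0) - 4 * (e₁ - e₂ - 1) / (1 + (e₁ - e₂ - 1) * x 0) - 4 * (e₂ - e₃ - 1) / (1 + (e₂ - e₃ - 1) * x 0)) rL.domain → ∃ (s : Literature.NumberTheory.Transcendental.KZ.IntegralRep 3) (sA sB sA' sL : Literature.NumberTheory.Transcendental.KZ.IntegralRep 1), s.domain = {x | -1 < x 0 ∧ x 0 < x 1 ∧ x 1 < x 2 ∧ x 2 < 0} ∧ Set.EqOn s.integrand (fun x => x 2 / (Real.sqrt (4 * x 0 ^ 3 - 4 * x 0) * Real.sqrt (4 * x 1 ^ 3 - 4 * x 1) * Real.sqrt (4 * x 2 ^ 3 - 4 * x 2))) s.domain ∧ sA.domain = {x | -1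 < x 0 ∧ x 0 < 0} ∧ Set.EqOn sA.integrand (fun x => 1 / Real.sqrt (4 * x 0 ^ 3 - 4 * x 0)) sA.domain ∧ sB.domain = {x | -1 < x 0 ∧ x 0 < 0} ∧ Set.EqOn sB.integrand (fun x => x 0 / Real.sqrt (4 * x 0 ^ 3 - 4 * x 0)) sB.domain ∧ sA'.domain = {x | 0 < x 0 ∧ x 0 < 1} ∧ Set.EqOn sA'.integrand (fun x => 1 / Real.sqrt (4 * x 0 - 4 * x 0 ^ 3)) sA'.domain ∧ sL.domain = {x | 0 < x 0 ∧ x 0 < 1} ∧ Set.EqOn sL.integrand (fun x => 24 / (1 + x 0)) sL.domain ∧ (48 • Literature.NumberTheory.Transcendental.KZ.of r - 8 • (Literature.NumberTheory.Transcendental.KZ.of rA * Literature.NumberTheory.Transcendental.KZ.of rA * Literature.NumberTheory.Transcendental.KZ.of rB) + 4 • (Literature.NumberTheory.Transcendental.KZ.of Literature.NumberTheory.Transcendental.KZ.piRep * Literature.NumberTheory.Transcendental.KZ.of rA') - Literature.NumberTheory.Transcendental.KZ.of rA * Literature.NumberTheory.Transcendental.KZ.of rL) - (48 • Literature.NumberTheory.Transcendental.KZ.of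 s - 8 • (Literature.NumberTheory.Transcendental.KZ.of sA * Literature.NumberTheory.Transcendental.KZ.of sA * Literature.NumberTheory.Transcendental.KZ.of sB) + 4 • (Literature.NumberTheory.Transcendental.KZ.of Literature.NumberTheory.Transcendental.KZ.piRep * Literature.NumberTheory.Transcendental.KZ.of sA') - Literature.NumberTheory.Transcendental.KZ.of sA * Literature.NumberTheory.Transcendental.KZ.of sL) ∈ Literature.NumberTheory.Transcendental.KZ.relations) →
    DepthThreeFamily := by
  intro hC hG hT e₁ e₂ e₃ ha₁ ha₂ ha₃ h₃₂ h₂₁ hsum r rA rB rA' rL h1 h2 h3 h4 h5 h6 h7 h8 h9 h10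
  obtain ⟨s, sA, sB, sA', sL, g1, g2, g3, g4, g5, g6, g7, g8, g9, g10, hdiff⟩ :=
    hT e₁ e₂ e₃ ha₁ ha₂ ha₃ h₃₂ h₂₁ hsum r rA rB rA' rL h1 h2 h3 h4 h5 h6 h7 h8 h9 h10
  have h0 : 48 • Literature.NumberTheory.Transcendental.KZ.of s - 8 • (Literature.NumberTheory.Transcendental.KZ.of sA * Literature.NumberTheory.Transcendental.KZ.of sA * Literature.NumberTheory.Transcendental.KZ.of sB) + 4 • (Literature.NumberTheory.Transcendental.KZ.of Literature.NumberTheory.Transcendental.KZ.piRep * Literature.NumberTheory.Transcendental.KZ.of sA') - Literature.NumberTheory.Transcendental.KZ.of sA * Literature.NumberTheory.Transcendental.KZ.of sL ∈ Literature.NumberTheory.Transcendental.KZ.relations :=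
    hG Summit.KontsevichZagierPeriods.GenusOneIterated.LegendreLemniscatic.legendreLemniscatic_proof hC
      s sA sB sA' sL g1 g2 g3 g4 g5 g6 g7 g8 g9 g10
  have key := Literature.NumberTheory.Transcendental.KZ.relations.add_mem hdiff h0
  rwa [sub_add_cancel] at key

/-- **Skeleton theorem, by name**: `DepthThreeFamily` from the three declared stubs. -/
theorem DepthThreeFamily_skeleton : DepthThreeFamily :=
  DepthThreeFamily_of stub_cuspLemniscatic stub_lemniscaticNormalForm stub_modulusTransport

end Summit.KontsevichZagierPeriods.KontsevichZagierPeriods.Cruxes.DepthThreeFamily.Birth
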